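import Mathlib
import HarnessLib
import HarnessLib.Audit
import Summits.Langlands.Statement

/-!
Route: SteinbergArtin

CLOSED (retired) 2026-08-15T13:48:45Z by operator:999:1257524 — reason: not-a-thesis: assembly does not conclude the sub-problem Statement — note: D-0027 §2.1 audit (human 2026-08-15: routes that do not decide the summit are removed): the assembly concludes `SteinbergStrongArtin`, not the sub-problem statement; a NEW conforming route may be opened from the same idea (generated `closes : … → _root_.Langlands`).. The file is kept as the record of this route; refuted decls are indexed as negative knowledge (`ledger negatives`).

# Route SteinbergArtin — strong Artin for the Steinberg–Artin family St∘ρ̄ (odd, orthogonal,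
residually Sym^(ℓ−1)) = automorphy of ζ_ℚ(C)/ζ, via free residual automorphy at p = ℓ

X (SteinbergStrongArtin): for every prime ℓ ≥ 5, every continuous surjective ODD ρ̄ : Γ_ℚ → GL₂(𝔽_ℓ)
and every continuous
σ : Γ_ℚ → GL_ℓ(ℂ) carrying the STEINBERG CHARACTER of ρ̄ (tr σ(g) = #{ρ̄(g)-stable lines in 𝔽_ℓ²} −
1, i.e. σ ≅ St_ℓ∘ρ̄, the
ℓ-dimensional constituent of ℂ[P¹(𝔽_ℓ)]), there is a cuspidal automorphic representation π of
GL_ℓ(𝔸_ℚ) whose Satake parameters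
match the Frobenius characteristic polynomials of σ at all but finitely many places. Equivalently:
ζ_K(s)/ζ(s) is the standard
L-function of a cusp form on GL_ℓ/ℚ for every field K = ℚ(C) of degree ℓ+1 cut out by a Borel
subgroup (C ⊂ E[ℓ] a cyclic subgroup
when ρ̄ = ρ̄_E,ℓ: 'ζ of the ℓ-isogeny field over ζ is automorphic'). X is an infinite explicit
family of instances of conjunct (B)
GaloisToAutomorphic of the summit at (F = ℚ, n = ℓ, ρ = σ, Hodge–Tate type 0) in its totally
degenerate insoluble sector; it
does not imply the summit, and the Assembly ends in X (acid family; precedent Parity/MinorArcs).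
Card realised:
steinberg-artin-dedekind (spine, sole card).
Lean: `∀ (ℓ : ℕ) [Fact ℓ.Prime], 5 ≤ ℓ → ∀ (ρ :
Literature.NumberTheory.GaloisRepresentations.FramedGaloisRep ℚ (ZMod ℓ) 2) (σ :
Literature.NumberTheory.GaloisRepresentations.FramedGaloisRep ℚ ℂ ℓ), Function.Surjective ρ →
ρ.IsOdd → (∀ g, ((σ g : Matrix (Fin ℓ) (Fin ℓ) ℂ)).trace = ((Nat.card {w : Fin 2 → ZMod ℓ // w ≠ 0 ∧
∃ a : ZMod ℓ, ((ρ g : Matrix (Fin 2) (Fin 2) (ZMod ℓ))).mulVec w = a • w} : ℂ)) / ((ℓ : ℂ) - 1) - 1)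
→ ∃ (hcpt : Literature.NumberTheory.Automorphic.isCompact_glFiniteIntegralLevel ℓ ℚ) (π :
Literature.NumberTheory.Automorphic.CuspidalAutomorphicRepData ℓ ℚ hcpt), ∀ᶠ v :
IsDedekindDomain.HeightOneSpectrum (NumberField.RingOfIntegers ℚ) in Filter.cofinite, ∃ α : Multiset
ℂ, π.1.HasSatakeParamAt v α ∧ σ.IsUnramifiedAt v ∧ σ.HasFrobCharpolyAt v
(Literature.NumberTheory.Automorphic.satakePolynomial α)`

## Assembly
Pure logic (proved sorry-free in Sketch.lean, `assembly_holds`): fix (ℓ, ρ̄, σ); ResidualRegularLift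
supplies the weight-zero cuspidal
Π congruent to σ, ArtinWeightLifting turns it into the cuspidal π matching σ; this is X. X is a
family of instances of conjunct
(B) (GaloisToAutomorphic at F = ℚ, n = ℓ, ρ = σ ⊗ ℚ̄_λ, Hodge–Tate type 0) and does NOT imply the
summit: the codomain of the
Assembly is X itself (precedent: Summits/Parity/BatemanHorn/Theses/MinorArcs), the summit entering
as the conjecture of which X is
the degenerate-weight acid family.

Rationale: WHY THIS LINE. Mechanism (card steinberg-artin-dedekind): in DEFINING characteristic the Steinberg
lattice reduces to the Steinberg module
St ⊗ 𝔽_ℓ ≅ Sym^(ℓ−1)(𝔽_ℓ²) = L(ℓ−1) (irreducible and projective; Humphreys2005 Ch. 9), so σ̄ ≅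
Sym^(ℓ−1)ρ̄, which is the reduction
of Sym^(ℓ−1)ρ_g for a weight-2 non-CM newform g with ρ̄_g ≅ ρ̄ (KhareWintenberger2009 +
AshStevens1986) and hence automorphic of
weight zero on GL_ℓ/ℚ by NewtonThorneIHES2021b: residual automorphy in REGULAR weight is free, with
adequate image although
p = ℓ = n (GuralnickHerzigTiep2017 Thm 1.7 / Cor 9.4, read — this discharges the audit caveat S1). σ
is odd (tr σ(c) = 1),
orthogonal, absolutely irreducible, tame at ℓ in the niveau-2 regime: every hypothesis of polarized
automorphy lifting holds
EXCEPT distinctness of the Hodge–Tate weights (all 0). The line isolates NonRegularWeightBarrier on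
one clean family and attacks
it ℓ-adically at p = ℓ: (i) big R = 𝕋 / density of automorphic points in R^pol of Sym^(ℓ−1)ρ̄
restricted to an imaginary
quadratic M (Allen2019 Thm 1, whose only failing hypothesis p ∤ 2n is inherited from Thorne2012 and
is absent from
Thorne2017TwoAdic Thm 5.1, read; HellmannMargerinSchraen2022), making σ|G_M a point of the
completed-cohomology Hecke algebra of
the definite unitary group U(ℓ); (ii) an Artin-weight classicality/descent statement with no engine
yet, shared with the even-Artin
cards, for which this family is the cleanest input (no parity trick, no induction, p odd). Imported
areas: modular representation
theory of finite groups of Lie type (defining-characteristic reduction, adequacy in dimension p) and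
deformation theory /
patching; the Dedekind-zeta identity makes outputs numerically checkable (LMFDB isogeny fields).
Calibration: the ℓ = 5 rung is
Calegari2013ArtinS5 (PGL₂(𝔽₅) ≅ S₅: weak automorphy of the 5-dimensional Steinberg constituent
proved, automorphy conditional on
a ζ_H non-vanishing). No Langlands route exists yet; negatives index empty.

RANKED CRUXES. #0 SteinbergStrongArtin (target) — X as in § Thesis (all primes ℓ ≥ 5; ρ̄ surjective
and odd; σ pinned up to conjugacy by the Steinberg character). (why it might fail: False only if
conjunct (B) fails for some St∘ρ̄ (nobody expects); as a METHOD target every known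
lifting/interpolation technique needs distinct Hodge–Tate weights or a limit-of-discrete-series
host, and σ has neither (HT = 0^ℓ; inf. char. 0 degenerate on U(a,b) and Sp_(ℓ−1)).)
[Calegari2013ArtinS5, NewtonThorneIHES2021b, CalegariGeraghty2017,
Literature.Barriers.Langlands.NonRegularWeightBarrier]
#2 ArtinWeightLifting (crux) — ARTIN-WEIGHT AUTOMORPHY LIFTING FOR THE STEINBERG FAMILY (card
S2+S3): for ℓ ≥ 5, ρ̄ surjective odd, σ with the Steinberg character of ρ̄ — IF σ is congruent
modulo a prime 𝔩 | ℓ of ℤ̄ ⊂ ℂ to a weight-zero (cohomological, trivial coefficients) cuspidal Π on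
GL_ℓ(𝔸_ℚ), i.e. Hecke polynomial of Π_p ≡ charpoly σ(Frob_p) mod 𝔩 for almost all p, THEN σ is
automorphic (a.e. Satake–Frobenius matching with a cuspidal π on GL_ℓ/ℚ). The hypothesis is a
theorem on paper (ResidualRegularLift); the content is lifting from HT weights (0,1,…,ℓ−1) to
(0,…,0) at p = ℓ = n. [difficulty: open-problem] (why it might fail: It is automorphy lifting to
EQUAL Hodge–Tate weights at p = ℓ = n: patching needs cohomology in l₀ > 0 degrees that Artin-type π
on GL_ℓ (ℓ ≥ 3) does not have (not even coherent: not a limit of discrete series), σ|D_ℓ is not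
trianguline, and weight −ρ has no classicality theorem on U(ℓ).) [CalegariGeraghty2017,
BarnetlambEtAl2014, Thorne2017TwoAdic, Allen2019, HellmannMargerinSchraen2022, Pan2022,
Literature.Barriers.Langlands.NonRegularWeightBarrier]
#4 RungFive (crux) — FIRST RUNG: the target at ℓ = 5 (PGL₂(𝔽₅) ≅ S₅; σ = Calegari's ρ₅): for every
odd surjective ρ̄ : Γ_ℚ → GL₂(𝔽₅), St∘ρ̄ is automorphic on GL₅/ℚ unconditionally.
Calegari2013ArtinS5 Thm 1.2 (read, p.2) proves it when the S₅-closure is unramified at 5 with Frob₅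
∈ 2B AND ζ_H(s) ≠ 0 for s ∈ (0,1), H the degree-12 field (verified by Booker for one field); for ρ̄
= ρ̄_E,5 the closure contains ℚ(√5) and is ramified at 5, so even his hypotheses are not met.
[difficulty: L] (why it might fail: Removing 'ζ_H ≠ 0 on (0,1)' needs either real-zero-freeness of
degree-12 Dedekind zetas uniformly (not implied by GRH alone) or a non-analytic identification of
Calegari's weak transfer ϖ with ρ₅ on the density-zero exceptional set; both are open.)
[Calegari2013ArtinS5, arXiv:1112.1152, Kim2002, KhareThorne2017, Booker2006]
#9 SteinbergCongruence (support) — DEFINING-CHARACTERISTIC MIRACLE (card claim (c)) in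
Brauer–Nesbitt-ready form: if σ has the Steinberg character of ρ̄ then for every g the
characteristic polynomial of σ(g) lies in ℤ[X] and reduces mod ℓ to ∏_(i=0)^(ℓ−1) (X − a^i
b^(ℓ−1−i)), (a, b) the eigenvalues of ρ̄(g) in any field over 𝔽_ℓ — i.e. σ̄^ss ≅ Sym^(ℓ−1)ρ̄ (St ⊗
𝔽_ℓ = L(ℓ−1)). Finite group theory, checked by hand on the four class types of GL₂(𝔽_ℓ) (central,
split, non-split, non-semisimple) in NOTES.md; provable now. [difficulty: provable-now]
[Humphreys2005, GuralnickHerzigTiep2017, SerreLinearRepresentations1977]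
#9 ResidualRegularLift (support) — FREE RESIDUAL AUTOMORPHY: for ℓ ≥ 5, ρ̄ surjective odd, σ
Steinberg-of-ρ̄, there is a weight-zero cuspidal Π on GL_ℓ(𝔸_ℚ) congruent to σ modulo a prime over ℓ
(= the hypothesis of ArtinWeightLifting). On paper: ρ̄ ≅ ρ̄_g for a weight-2 newform g of level
N(ρ̄)ℓ² (KhareWintenberger2009; AshStevens1986 Thm 3.5), g non-CM (im ρ̄ ⊇ SL₂(𝔽_ℓ)); Π :=
Sym^(ℓ−1)π_g is cuspidal of weight zero (NewtonThorneIHES2021b Thm A; HT 0,…,ℓ−1) with integral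
Hecke polynomial ∏(X − (√p·α)^i(√p·β)^(ℓ−1−i)) ≡ Sym^(ℓ−1) charpoly ρ̄(Frob_p) ≡ charpoly σ(Frob_p)
(SteinbergCongruence). Stated fact-free (no named-fact hypotheses) to keep the route's import cone
clean; not dischargeable in Lean before lang.S24 and Serre's conjecture are. [difficulty: L]
[KhareWintenberger2009, AshStevens1986, NewtonThorneIHES2021b, NewtonThorneIHES2021a]
#9 SteinbergArtinExists (support) — CONSTRUCTION (never smuggled into the interface): for every
continuous ρ̄ : Γ_ℚ → GL₂(𝔽_ℓ) there is a continuous σ : Γ_ℚ → GL_ℓ(ℂ) with the Steinberg character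
of ρ̄ — σ = (ℂ[P¹(𝔽_ℓ)] ⊖ 𝟙)∘ρ̄ in any basis; continuity because ρ̄ has open kernel. Makes the
family non-empty; the character pins σ up to GL_ℓ(ℂ)-conjugacy. [difficulty: provable-now]
[SerreLinearRepresentations1977, Humphreys2005]
#9 RungFiveWeak (support) — CALIBRATION (ℓ = 5, weak form): for odd surjective ρ̄ : Γ_ℚ → GL₂(𝔽₅)
there is a cuspidal ϖ on GL₅/ℚ matching σ = St∘ρ̄ at a set of finite places of natural density one.
Calegari2013ArtinS5 Thm 1.1 gives this for closures unramified at 5 with Frob₅ ∈ 2B, and states that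
the local condition at 5 'is not essential to the method' (p.2); it entered through [Sasaki1,2] and
should disappear when the modularity of the totally odd icosahedral ϱ over the real quadratic
subfield is taken from Pilloni–Stroh 2016 / Sasaki 2019 (p ramified allowed). Known on paper modulo
that substitution; the rung below RungFive. [difficulty: M] [Calegari2013ArtinS5, Kim2002,
PilloniStroh2016 (Asterisque 382), Sasaki2019 (Invent. math. 215)]

TWO-LAYER PLAN. ArtinWeightLifting ⇐ ProAutomorphyBigRT → ArtinWeightClassicality →
ArtinWeightLifting (k = 2): ProAutomorphyBigRT is filed now
as an informal rank-3 crux (density of automorphic points / big R = 𝕋 for Sym^(ℓ−1)ρ̄|G_M at p = ℓ =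
n in the niveau-2 regime);
ArtinWeightClassicality ('an 𝒪-point of 𝕋^big_𝔪(U(ℓ)) with Hodge–Tate weights 0 and finite monodromy
is classical on GL_ℓ(𝔸_M)
and descends to ℚ') is typed when completed cohomology has a carrier. SteinbergStrongArtin ⇐
niveau-2 regime (ρ̄|G_ℚℓ
irreducible) → ordinary regime → X. RungFive ⇐ RungFiveWeak → identification on the density-zero set
→ RungFive.

KILL CRITERIA. (i) An irreducible component of Spec R^pol(Sym^(ℓ−1)ρ̄|G_M) without automorphic
points for some niveau-2 (ℓ, ρ̄) (a genuine
p = n obstruction) refutes ProAutomorphyBigRT and closes the ℓ-adic line (close exhausted: there is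
no p ≠ ℓ door, σ mod p ≠ ℓ
being an insoluble ℓ-dimensional representation with no free residual automorphy). (ii) A theorem
that Artin-weight points of
𝕋^big(U(n)), n ≥ 3, are isolated from classical points in every usable sense kills
ArtinWeightLifting as a method (route
dormant; X survives as the typed acid-family target). (iii) RungFive refuted (some St∘ρ̄ at ℓ = 5
provably non-automorphic)
refutes X and conjunct (B): close refuted:RungFive. (iv) X proved elsewhere (non-solvable base
change / trace-formula
breakthrough) moots the route.

NOT DECOMPOSED YET. Local engineering at ℓ (solvable CM base change killing ρ̄(I_ℓ) while keeping a
Frobenius of order ℓ+1 mod centre, so that σ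
becomes unramified above ℓ with regular semisimple Frobenius — the Buzzard–Taylor-type hypothesis);
the ordinary regime
(Hom(r̄_v, r̄_v(1)) may be non-zero); potential diagonalisability of Sym^(ℓ−1)ρ_g one step outside
the Fontaine–Laffaille range
(HT range ℓ−1 = p−1); the descent M → ℚ (Arthur–Clozel, routine given cuspidality); the Dedekind
face 'ζ_ℚ(C)/ζ entire' (Artin
holomorphy for σ: open for PGL₂(𝔽_ℓ)-closures, known for sub-solvable closures only — Uchida, van
der Waall; Murty–Raghuram
2000), a Literature-side target needing a dedekindZeta-continuation carrier; oddness / orthogonality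
/ irreducibility of σ
(provable-now lemmas) ride with SteinbergCongruence via --supports.

CHEAPEST FALSIFIER. Run during planning: (1) the card's kill-test (i), adequacy of
Sym^(ℓ−1)(SL₂(𝔽_ℓ)) ⊂ GL_ℓ(𝔽̄_ℓ) at p = ℓ, comes out TRUE for
ℓ ≥ 5 (GuralnickHerzigTiep2017 Cor. 9.4, read p.34: the only non-adequate SL₂(p)-modules have
dimension (p±1)/2; Thm 1.7 for
overgroups in dimension p), so the Khare–Thorne p = 5 phenomenon (dimension 2 = (p−1)/2) does not
recur; (2) 'p ∤ 2n' in
Allen2019 Thm 1 (read p.3) is inherited from Thorne2012, while Thorne2017TwoAdic Thm 5.1 (read pp.2,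
38) is stated for every p
with GHT-adequacy (p | n allowed). Cheapest remaining: (a) kit/LMFDB sanity for E = 11a1, ℓ = 7: K =
ℚ(C) of degree 8,
check ζ_K/ζ against the degree-7 functional equation with conductor cond(σ) and Booker-style absence
of real-zero/pole
pathology; (b) literature: is an essential use of p ∤ n hiding in the R = 𝕋 statement behind
Thorne2017TwoAdic Cor. 4.3 or in
HellmannMargerinSchraen2022's genericity hypotheses at p = n?

NUMBERS. dim σ = ℓ; [ℚ(C):ℚ] = ℓ+1; tr σ(c) = 1 (σ(c) ∼ diag(1^((ℓ+1)/2), (−1)^((ℓ−1)/2))); det σ =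
χ_ℓ* (quadratic); HT(σ) = (0,…,0);
HT(Sym^(ℓ−1)ρ_g) = (0,1,…,ℓ−1) for g of weight 2 (Fontaine–Laffaille bound p−2 = ℓ−2 exceeded by 1);
in the niveau-2 regime
σ|I_ℓ = ⊕_(j=1..ℓ) ε^j, ε tame of order ℓ+1 (multiplicity-free, no cyclotomic shifts, Hom(r̄_v,
r̄_v(1)) = 0); adequacy for
all ℓ ≥ 5 (GHT Cor 9.4); Allen2019 Thm 1 hypotheses: p ∤ 2n FAILS (p = n), all others arranged;
first open rung ℓ = 5
(dimension 5, sextic K), first rung without exceptional isomorphism ℓ = 7 (dimension 7, octic K,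
e.g. E = 11a1). Items at
open: 8 (1 target, 2 typed cruxes, 4 support, 1 assembly) + 1 informal crux (ProAutomorphyBigRT,
rank 3) filed after open.

DEFINITION REQUESTS. steinbergArtinRep (topic Summits/Langlands/Langlands/Theorems): the continuous
representation Γ_ℚ → GL_ℓ(ℂ) on ℂ[P¹(𝔽_ℓ)] ⊖ 𝟙
composed with ρ̄ (the witness of SteinbergArtinExists), so that later items can name 'the' σ instead
of repeating the character
condition. No Literature notion is missing for the typed items (FramedGaloisRep, IsOdd,
HasSatakeParamAt,
HasHeckePolynomialAt, HasWeightZero, satakePolynomial, FramedRep.charpoly are accepted declarations;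
checked with lean check).

Novelty: Searches (2026-08-15): lit search --source zbmath "Artin conjecture Steinberg representation" (2,
irrelevant: Gross 1997,
Plymen–Leung 1991); "strong Artin conjecture odd orthogonal representations" (0); "Artin L-function
PSL(2,7)" (0); "Dedekind
conjecture zeta quotient" (8, none on PGL₂(𝔽_ℓ)-closures); "Heilbronn character Dedekind conjecture"
(8: Murty–Raghuram 2000
zbl:1044.11099, Foote–Ginsberg–Murty 2015 doi:10.1090/bull/1492 — ζ_K/ζ_k entire known for
sub-solvable closures only);
lit galaxy search "Artin conjecture for the Steinberg representation" --star all (0); "Dedekind's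
conjecture" --star all (7 books,
Murty–Murty Non-vanishing of L-functions); lit frontier Langlands --since 2021 (30 rows, none on
Artin-weight lifting in rank > 2);
lit bridges Langlands --cross any (generic); plus the card's and the auditor's arXiv/zbMATH searches
(Calegari S₅: 1 hit; 'Artin
representation congruent symmetric power Steinberg mod p': 0). READ: Calegari2013ArtinS5 pp.2,4 (Thm
1.1, Thm 1.2, Lemma 2.3),
GuralnickHerzigTiep2017 pp.3–4, 34 (Thm 1.7, Cor 9.4), Allen2019 pp.3–5 (Thm 1), Thorne2017TwoAdic
pp.2, 38 (Thm 1.1 = 5.1).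
Nearest prior art found: Calegari2013ArtinS5 (arXiv:1112.1152) — the ℓ = 5 rung through PGL₂(𝔽₅) ≅
S₅ with a complex engine
(icosahedral ϱ over ℚ(√5), Kim2002 Sym⁴/∧², L-function identification), stuck exactly on the
5-dimensional Steinberg constituent;
NewtonThorneIHES2021b (Sym^n); GuralnickHerzigTiep2017 (adequacy in dimension p); Allen2019 /
Thorne2017TwoAdi  [refs: 10.1090/bull/1492, 1112.1152, doi:10.1090/bull/1492, GuralnickHerzigTiep2017, Allen2019, Kim2002, NewtonThorneIHES2021b]

Barriers (technique_class: defining-characteristic-reduction automorphy-lifting): - technique_class: defining-characteristic-reduction automorphy-lifting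
- Literature.Barriers.Langlands.NonRegularWeightBarrier: NOT evaded — isolated. σ has HT weights
(0,…,0); the catalogued technique class sees only regular weights, and σ is not even a limit of
discrete series on any host (U(a,b), Sp_(ℓ−1): inf. char. 0 singular on compact roots), so the
coherent evasions_known (weight one, CalegariGeraghty2017) do not apply. The bet: a family on which
this is provably the ONLY missing hypothesis (oddness, self-duality, residual automorphy, adequacy,
finite local monodromy all hold) is the right test object for any Artin-weight technology, and big R
= 𝕋 at p = n (ProAutomorphyBigRT) is reachable now.
- Literature.Barriers.Langlands.SolvableImageBarrier: met head-on (projective image PGL₂(𝔽_ℓ),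
insoluble for ℓ ≥ 5); evaded at the RESIDUAL level by defining-characteristic reduction (congruence
to Sym^(ℓ−1) of a GL₂ form) instead of base change along the splitting field; not evaded in
characteristic 0 (that is ArtinWeightLifting); the non-normal-descent gap of
SolvableImageBarrierNarrow is not used.
- Literature.Barriers.Langlands.ResiduallyReducibleBarrier: evaded — σ̄ = Sym^(ℓ−1)ρ̄ is absolutely
irreducible with Ext¹ = 0 (projective Steinberg module) and adequate image for ℓ ≥ 5
(GuralnickHerzigTiep2017 Cor 9.4: the non-adequate SL₂(p)-modules have dimension (p±1)/2 — the
Khare–Thorne p = 5 phenomenon in dimension 2, not ours).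
- Literature.Barriers.Langlands.TaylorWilesNum

History (route lifecycle, newest last):
- 2026-08-15T13:48:45Z · CLOSED retired — not-a-thesis: assembly does not conclude the sub-problem Statement (operator:999:1257524)

sub-problem: Langlands · status: closed(retired) · opened planner-plancard-Langlands-Langlands-steinber-ca742ef6-0 2026-08-15T11:15:39Z · rev 1 · ledger route-Langlands-SteinbergArtin
GENERATED by the gate from the ledger (D-0016/17). Provers cite these decls: `theorem foo : Summit.Langlands.Langlands.Theses.SteinbergArtin.<Decl> := …` in Summits/Langlands/Langlands/Theorems/<Name>.lean.
-/

namespace Summit.Langlands.Langlands.Theses.SteinbergArtin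

open scoped BigOperators Topology Manifold Classical MeasureTheory ProbabilityTheory Matrix InnerProductSpace ComplexConjugate ContinuousMap
open Filter Set Function TopologicalSpace MeasureTheory

attribute [summit_statement] _root_.Langlands

/-- item stmt-Langlands-3289 · target · rank 0 · closed · moot by None · by planner
why it might fail: False only if conjunct (B) fails for some St∘ρ̄ (nobody expects); as a METHOD target every known lifting/interpolation technique needs distinct Hodge–Tate weights or a limit-of-discrete-series host, and σ has neither (HT = 0^ℓ; inf. char. 0 degenerate on U(a,b) and Sp_(ℓ−1)).
sources: Calegari2013ArtinS5, NewtonThorneIHES2021b, CalegariGeraghty2017, Literature.Barriers.Langlands.NonRegularWeightBarrier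
[target] X as in § Thesis (all primes ℓ ≥ 5; ρ̄ surjective and odd; σ pinned up to conjugacy by the
Steinberg character). -/
@[route_item "route-Langlands-SteinbergArtin"]
def SteinbergStrongArtin : Prop :=
  ∀ (ℓ : ℕ) [Fact ℓ.Prime], 5 ≤ ℓ → ∀ (ρ : Literature.NumberTheory.GaloisRepresentations.FramedGaloisRep ℚ (ZMod ℓ) 2) (σ : Literature.NumberTheory.GaloisRepresentations.FramedGaloisRep ℚ ℂ ℓ), Function.Surjective ρ → ρ.IsOdd → (∀ g, ((σ g : Matrix (Fin ℓ) (Fin ℓ) ℂ)).trace = ((Nat.card {w : Fin 2 → ZMod ℓ // w ≠ 0 ∧ ∃ a : ZMod ℓ, ((ρ g : Matrix (Fin 2) (Fin 2) (ZMod ℓ))).mulVec w = a • w} : ℂ)) / ((ℓ : ℂ) - 1) - 1) → ∃ (hcpt : Literature.NumberTheory.Automorphic.isCompact_glFiniteIntegralLevel ℓ ℚ) (π : Literature.NumberTheory.Automorphic.CuspidalAutomorphicRepData ℓ ℚ hcpt), ∀ᶠ v : IsDedekindDomain.HeightOneSpectrum (NumberField.RingOfIntegers ℚ) in Filter.cofinite,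 ∃ α : Multiset ℂ, π.1.HasSatakeParamAt v α ∧ σ.IsUnramifiedAt v ∧ σ.HasFrobCharpolyAt v (Literature.NumberTheory.Automorphic.satakePolynomial α)

/-- item stmt-Langlands-3290 · crux · rank 2 · closed · moot by None · by planner
why it might fail: It is automorphy lifting to EQUAL Hodge–Tate weights at p = ℓ = n: patching needs cohomology in l₀ > 0 degrees that Artin-type π on GL_ℓ (ℓ ≥ 3) does not have (not even coherent: not a limit of discrete series), σ|D_ℓ is not trianguline, and weight −ρ has no classicality theorem on U(ℓ).
sources: CalegariGeraghty2017, BarnetlambEtAl2014, Thorne2017TwoAdic, Allen2019, HellmannMargerinSchraen2022, Pan2022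
[crux] ARTIN-WEIGHT AUTOMORPHY LIFTING FOR THE STEINBERG FAMILY (card S2+S3): for ℓ ≥ 5, ρ̄
surjective odd, σ with the Steinberg character of ρ̄ — IF σ is congruent modulo a prime 𝔩 | ℓ of ℤ̄
⊂ ℂ to a weight-zero (cohomological, trivial coefficients) cuspidal Π on GL_ℓ(𝔸_ℚ), i.e. Hecke
polynomial of Π_p ≡ charpoly σ(Frob_p) mod 𝔩 for almost all p, THEN σ is automorphic (a.e.
Satake–Frobenius matching with a cuspidal π on GL_ℓ/ℚ). The hypothesis is a theorem on paper
(ResidualRegularLift); the content is lifting from HT weights (0,1,…,ℓ−1) to (0,…,0) at p = ℓ = n.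
[difficulty: open-problem] -/
@[route_item "route-Langlands-SteinbergArtin"]
def ArtinWeightLifting : Prop :=
  ∀ (ℓ : ℕ) [Fact ℓ.Prime], 5 ≤ ℓ → ∀ (ρ : Literature.NumberTheory.GaloisRepresentations.FramedGaloisRep ℚ (ZMod ℓ) 2) (σ : Literature.NumberTheory.GaloisRepresentations.FramedGaloisRep ℚ ℂ ℓ), Function.Surjective ρ → ρ.IsOdd → (∀ g, ((σ g : Matrix (Fin ℓ) (Fin ℓ) ℂ)).trace = ((Nat.card {w : Fin 2 → ZMod ℓ // w ≠ 0 ∧ ∃ a : ZMod ℓ, ((ρ g : Matrix (Fin 2) (Fin 2) (ZMod ℓ))).mulVec w = a • w} : ℂ)) / ((ℓ : ℂ) - 1) - 1) → (∃ (hcpt' : Literature.NumberTheory.Automorphic.isCompact_glFiniteIntegralLevel ℓ ℚ) (piR : Literature.NumberTheory.Automorphic.CuspidalAutomorphicRepData ℓ ℚ hcpt'), piR.1.HasWeightZero ∧ ∃ 𝔩 : Ideal ↥(integralClosure ℤ ℂ), 𝔩.IsMaximal ∧ ((ℓ : ℕ) : ↥(integralClosure ℤ ℂ)) ∈ 𝔩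 ∧ ∀ᶠ v : IsDedekindDomain.HeightOneSpectrum (NumberField.RingOfIntegers ℚ) in Filter.cofinite, ∃ (P : Polynomial ↥(integralClosure ℤ ℂ)) (Q : Polynomial ℤ), piR.1.HasHeckePolynomialAt v (P.map (algebraMap ↥(integralClosure ℤ ℂ) ℂ)) ∧ σ.IsUnramifiedAt v ∧ σ.HasFrobCharpolyAt v (Q.map (Int.castRingHom ℂ)) ∧ P.map (Ideal.Quotient.mk 𝔩) = (Q.map (Int.castRingHom ↥(integralClosure ℤ ℂ))).map (Ideal.Quotient.mk 𝔩)) → ∃ (hcpt : Literature.NumberTheory.Automorphic.isCompact_glFiniteIntegralLevel ℓ ℚ) (π : Literature.NumberTheory.Automorphic.CuspidalAutomorphicRepData ℓ ℚ hcpt), ∀ᶠ v : IsDedekindDomain.HeightOneSpectrum (NumberField.RingOfIntegers ℚ) in Filter.cofinite, ∃ α : Multiset ℂ, π.1.HasSatakeParamAt v α ∧ σ.IsUnramifiedAt v ∧ σ.HasFrobCharpolyAt v (Literature.NumberTheory.Automorphic.satakePolynomial α)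

-- item stmt-Langlands-3388 · crux · rank 3 · closed · moot by None · by planner — informal only, no Lean statement yet:
--   [crux] PRO-AUTOMORPHY AT WEIGHT −ρ / BIG R = 𝕋 AT p = n (card step (1) = S2; rank 3). Fix ℓ ≥ 5, ρ̄
--   : Γ_ℚ ↠ GL₂(𝔽_ℓ) odd with ρ̄|G_ℚℓ irreducible (niveau 2), M/ℚ imaginary quadratic with ℓ split, S ⊇
--   {ℓ, primes where ρ̄ ramifies}; r̄ := Sym^(ℓ−1)ρ̄ restricted to G_(M,S) (≅ σ̄ by SteinbergCongruence;
--   RACSDC-automorphic by ResidualRegularLift + quadratic base change; r̄(G_M(ζ_ℓ)) ⊇ PSL₂(𝔽_ℓ) acting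
--   on L(ℓ−1), adequate by GuralnickHerzigTiep2017 Cor 9.4 / Thm 1.7). CLAIM: every irreducible
--   component of Spec R^pol_S(r̄) (polarized deformations, r^c ≅ r^∨ ε^(1−ℓ)) contains a point arising
--   from a RA

/-- item stmt-Langlands-3291 · crux · rank 4 · closed · moot by None · by planner
why it might fail: Removing 'ζ_H ≠ 0 on (0,1)' needs either real-zero-freeness of degree-12 Dedekind zetas uniformly (not implied by GRH alone) or a non-analytic identification of Calegari's weak transfer ϖ with ρ₅ on the density-zero exceptional set; both are open.
sources: Calegari2013ArtinS5, arXiv:1112.1152, Kim2002, KhareThorne2017, Booker2006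
[crux] FIRST RUNG: the target at ℓ = 5 (PGL₂(𝔽₅) ≅ S₅; σ = Calegari's ρ₅): for every odd surjective
ρ̄ : Γ_ℚ → GL₂(𝔽₅), St∘ρ̄ is automorphic on GL₅/ℚ unconditionally. Calegari2013ArtinS5 Thm 1.2
(read, p.2) proves it when the S₅-closure is unramified at 5 with Frob₅ ∈ 2B AND ζ_H(s) ≠ 0 for s ∈
(0,1), H the degree-12 field (verified by Booker for one field); for ρ̄ = ρ̄_E,5 the closure
contains ℚ(√5) and is ramified at 5, so even his hypotheses are not met. [difficulty: L] -/
@[route_item "route-Langlands-SteinbergArtin"]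
def RungFive : Prop :=
  ∀ (ℓ : ℕ) [Fact ℓ.Prime], ℓ = 5 → ∀ (ρ : Literature.NumberTheory.GaloisRepresentations.FramedGaloisRep ℚ (ZMod ℓ) 2) (σ : Literature.NumberTheory.GaloisRepresentations.FramedGaloisRep ℚ ℂ ℓ), Function.Surjective ρ → ρ.IsOdd → (∀ g, ((σ g : Matrix (Fin ℓ) (Fin ℓ) ℂ)).trace = ((Nat.card {w : Fin 2 → ZMod ℓ // w ≠ 0 ∧ ∃ a : ZMod ℓ, ((ρ g : Matrix (Fin 2) (Fin 2) (ZMod ℓ))).mulVec w = a • w} : ℂ)) / ((ℓ : ℂ) - 1) - 1) → ∃ (hcpt : Literature.NumberTheory.Automorphic.isCompact_glFiniteIntegralLevel ℓ ℚ) (π : Literature.NumberTheory.Automorphic.CuspidalAutomorphicRepData ℓ ℚ hcpt), ∀ᶠ v : IsDedekindDomain.HeightOneSpectrum (NumberField.RingOfIntegers ℚ) in Filter.cofinite, ∃ α : Multiset ℂ, π.1.HasSatakeParamAt v α ∧ σ.IsUnramifiedAt v ∧ σ.HasFrobCharpolyAt v (Literature.NumberTheory.Automorphic.satakePolynomial 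α)

/-- item stmt-Langlands-3292 · support · rank 9 · closed · moot by None · by planner
sources: Humphreys2005, GuralnickHerzigTiep2017, SerreLinearRepresentations1977
[support] DEFINING-CHARACTERISTIC MIRACLE (card claim (c)) in Brauer–Nesbitt-ready form: if σ has
the Steinberg character of ρ̄ then for every g the characteristic polynomial of σ(g) lies in ℤ[X]
and reduces mod ℓ to ∏_(i=0)^(ℓ−1) (X − a^i b^(ℓ−1−i)), (a, b) the eigenvalues of ρ̄(g) in any field
over 𝔽_ℓ — i.e. σ̄^ss ≅ Sym^(ℓ−1)ρ̄ (St ⊗ 𝔽_ℓ = L(ℓ−1)). Finite group theory, checked by hand on the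
four class types of GL₂(𝔽_ℓ) (central, split, non-split, non-semisimple) in NOTES.md; provable now.
[difficulty: provable-now] -/
@[route_item "route-Langlands-SteinbergArtin"]
def SteinbergCongruence : Prop :=
  ∀ (ℓ : ℕ) [Fact ℓ.Prime] (ρ : Literature.NumberTheory.GaloisRepresentations.FramedGaloisRep ℚ (ZMod ℓ) 2) (σ : Literature.NumberTheory.GaloisRepresentations.FramedGaloisRep ℚ ℂ ℓ), (∀ g, ((σ g : Matrix (Fin ℓ) (Fin ℓ) ℂ)).trace = ((Nat.card {w : Fin 2 → ZMod ℓ // w ≠ 0 ∧ ∃ a : ZMod ℓ, ((ρ g : Matrix (Fin 2) (Fin 2) (ZMod ℓ))).mulVec w = a • w} : ℂ)) / ((ℓ : ℂ) - 1) - 1) → ∀ g, ∃ Q : Polynomial ℤ, Q.map (Int.castRingHom ℂ) = Literature.NumberTheory.GaloisRepresentations.FramedRep.charpoly σ g ∧ ∀ (k : Type) [Field k] [Algebra (ZMod ℓ) k] (a b : k), (Literature.NumberTheory.GaloisRepresentations.FramedRep.charpoly ρ g).map (algebraMap (ZMod ℓ) k) = (Polynomial.X - Polynomial.C a) * (Polynomial.X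 - Polynomial.C b) → Q.map (Int.castRingHom k) = ∏ i ∈ Finset.range ℓ, (Polynomial.X - Polynomial.C (a ^ i * b ^ (ℓ - 1 - i)))

/-- item stmt-Langlands-3293 · support · rank 9 · closed · moot by None · by planner
sources: KhareWintenberger2009, AshStevens1986, NewtonThorneIHES2021b, NewtonThorneIHES2021a
[support] FREE RESIDUAL AUTOMORPHY: for ℓ ≥ 5, ρ̄ surjective odd, σ Steinberg-of-ρ̄, there is a
weight-zero cuspidal Π on GL_ℓ(𝔸_ℚ) congruent to σ modulo a prime over ℓ (= the hypothesis of
ArtinWeightLifting). On paper: ρ̄ ≅ ρ̄_g for a weight-2 newform g of level N(ρ̄)ℓ²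
(KhareWintenberger2009; AshStevens1986 Thm 3.5), g non-CM (im ρ̄ ⊇ SL₂(𝔽_ℓ)); Π := Sym^(ℓ−1)π_g is
cuspidal of weight zero (NewtonThorneIHES2021b Thm A; HT 0,…,ℓ−1) with integral Hecke polynomial ∏(X
− (√p·α)^i(√p·β)^(ℓ−1−i)) ≡ Sym^(ℓ−1) charpoly ρ̄(Frob_p) ≡ charpoly σ(Frob_p)
(SteinbergCongruence). Stated fact-free (no named-fact hypotheses) to keep the route's import cone
clean; not dischargeable in Lean before lang.S24 and Serre's conjecture are. [difficulty: L] -/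
@[route_item "route-Langlands-SteinbergArtin"]
def ResidualRegularLift : Prop :=
  ∀ (ℓ : ℕ) [Fact ℓ.Prime], 5 ≤ ℓ → ∀ (ρ : Literature.NumberTheory.GaloisRepresentations.FramedGaloisRep ℚ (ZMod ℓ) 2) (σ : Literature.NumberTheory.GaloisRepresentations.FramedGaloisRep ℚ ℂ ℓ), Function.Surjective ρ → ρ.IsOdd → (∀ g, ((σ g : Matrix (Fin ℓ) (Fin ℓ) ℂ)).trace = ((Nat.card {w : Fin 2 → ZMod ℓ // w ≠ 0 ∧ ∃ a : ZMod ℓ, ((ρ g : Matrix (Fin 2) (Fin 2) (ZMod ℓ))).mulVec w = a • w} : ℂ)) / ((ℓ : ℂ) - 1) - 1) → ∃ (hcpt' : Literature.NumberTheory.Automorphic.isCompact_glFiniteIntegralLevel ℓ ℚ) (piR : Literature.NumberTheory.Automorphic.CuspidalAutomorphicRepData ℓ ℚ hcpt'), piR.1.HasWeightZero ∧ ∃ 𝔩 : Ideal ↥(integralClosure ℤ ℂ), 𝔩.IsMaximal ∧ ((ℓ : ℕ) : ↥(integralClosure ℤ ℂ)) ∈ 𝔩 ∧ ∀ᶠ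 v : IsDedekindDomain.HeightOneSpectrum (NumberField.RingOfIntegers ℚ) in Filter.cofinite, ∃ (P : Polynomial ↥(integralClosure ℤ ℂ)) (Q : Polynomial ℤ), piR.1.HasHeckePolynomialAt v (P.map (algebraMap ↥(integralClosure ℤ ℂ) ℂ)) ∧ σ.IsUnramifiedAt v ∧ σ.HasFrobCharpolyAt v (Q.map (Int.castRingHom ℂ)) ∧ P.map (Ideal.Quotient.mk 𝔩) = (Q.map (Int.castRingHom ↥(integralClosure ℤ ℂ))).map (Ideal.Quotient.mk 𝔩)

/-- item stmt-Langlands-3294 · support · rank 9 · closed · moot by None · by planner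
sources: SerreLinearRepresentations1977, Humphreys2005
[support] CONSTRUCTION (never smuggled into the interface): for every continuous ρ̄ : Γ_ℚ → GL₂(𝔽_ℓ)
there is a continuous σ : Γ_ℚ → GL_ℓ(ℂ) with the Steinberg character of ρ̄ — σ = (ℂ[P¹(𝔽_ℓ)] ⊖ 𝟙)∘ρ̄
in any basis; continuity because ρ̄ has open kernel. Makes the family non-empty; the character pins
σ up to GL_ℓ(ℂ)-conjugacy. [difficulty: provable-now] -/
@[route_item "route-Langlands-SteinbergArtin"]
def SteinbergArtinExists : Prop :=
  ∀ (ℓ : ℕ) [Fact ℓ.Prime] (ρ : Literature.NumberTheory.GaloisRepresentations.FramedGaloisRep ℚ (ZMod ℓ) 2), ∃ σ : Literature.NumberTheory.GaloisRepresentations.FramedGaloisRep ℚ ℂ ℓ, (∀ g, ((σ g : Matrix (Fin ℓ) (Fin ℓ) ℂ)).trace = ((Nat.card {w : Fin 2 → ZMod ℓ // w ≠ 0 ∧ ∃ a : ZMod ℓ, ((ρ g : Matrix (Fin 2) (Fin 2) (ZMod ℓ))).mulVec w = a • w} : ℂ)) / ((ℓ : ℂ) - 1) - 1)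

/-- item stmt-Langlands-3295 · support · rank 9 · closed · moot by None · by planner
sources: Calegari2013ArtinS5, Kim2002, PilloniStroh2016 (Asterisque 382), Sasaki2019 (Invent. math. 215)
[support] CALIBRATION (ℓ = 5, weak form): for odd surjective ρ̄ : Γ_ℚ → GL₂(𝔽₅) there is a cuspidal
ϖ on GL₅/ℚ matching σ = St∘ρ̄ at a set of finite places of natural density one. Calegari2013ArtinS5
Thm 1.1 gives this for closures unramified at 5 with Frob₅ ∈ 2B, and states that the local condition
at 5 'is not essential to the method' (p.2); it entered through [Sasaki1,2] and should disappear
when the modularity of the totally odd icosahedral ϱ over the real quadratic subfield is taken from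
Pilloni–Stroh 2016 / Sasaki 2019 (p ramified allowed). Known on paper modulo that substitution; the
rung below RungFive. [difficulty: M] -/
@[route_item "route-Langlands-SteinbergArtin"]
def RungFiveWeak : Prop :=
  ∀ (ℓ : ℕ) [Fact ℓ.Prime], ℓ = 5 → ∀ (ρ : Literature.NumberTheory.GaloisRepresentations.FramedGaloisRep ℚ (ZMod ℓ) 2) (σ : Literature.NumberTheory.GaloisRepresentations.FramedGaloisRep ℚ ℂ ℓ), Function.Surjective ρ → ρ.IsOdd → (∀ g, ((σ g : Matrix (Fin ℓ) (Fin ℓ) ℂ)).trace = ((Nat.card {w : Fin 2 → ZMod ℓ // w ≠ 0 ∧ ∃ a : ZMod ℓ, ((ρ g : Matrix (Fin 2) (Fin 2) (ZMod ℓ))).mulVec w = a • w} : ℂ)) / ((ℓ : ℂ) - 1) - 1) → ∃ (hcpt : Literature.NumberTheory.Automorphic.isCompact_glFiniteIntegralLevel ℓ ℚ) (π : Literature.NumberTheory.Automorphic.CuspidalAutomorphicRepData ℓ ℚ hcpt), Filter.Tendsto (fun x : ℕ => (Nat.card {v : IsDedekindDomain.HeightOneSpectrum (NumberField.RingOfIntegers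 ℚ) // v.residueCard ≤ x ∧ ∃ α : Multiset ℂ, π.1.HasSatakeParamAt v α ∧ σ.IsUnramifiedAt v ∧ σ.HasFrobCharpolyAt v (Literature.NumberTheory.Automorphic.satakePolynomial α)} : ℝ) / (Nat.card {v : IsDedekindDomain.HeightOneSpectrum (NumberField.RingOfIntegers ℚ) // v.residueCard ≤ x} : ℝ)) Filter.atTop (nhds 1)

/-- item stmt-Langlands-3296 · assembly · rank 1 · closed · moot by None · by planner
sources: Calegari2013ArtinS5, NewtonThorneIHES2021b
[assembly] ArtinWeightLifting → ResidualRegularLift → SteinbergStrongArtin. -/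
@[route_item "route-Langlands-SteinbergArtin"]
def Assembly : Prop :=
  ArtinWeightLifting → ResidualRegularLift → SteinbergStrongArtin

end Summit.Langlands.Langlands.Theses.SteinbergArtin
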